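import Summits.QuantumFields.QCD.Theorems.SpectralDefectExtinctionWindowExtinctionChessboardDefs
import Summits.QuantumFields.QCD.Theorems.SpectralDefectExtinctionAFBookkeeping
import Literature.MathematicalPhysics.QuantumFieldTheory.QCDPhaseQuenched

/-!
# Crux `WindowExtinction` (stmt-QuantumFields-8964), line `chessboard-cold-cells` — TRUE fragments of
`stub_transfer` (S3, the phase-quenched transfer)

`stub_transfer : TransferStmt` (the `∏_f |det D_W(m_f(k))|` tilt costs at most one nat per flat cube) is
the rank-1 OPEN input of the line.  This support file lands the parts of it that are theorems now:

* `tendsto_beta_atTop_of_hasAsymptoticScaling` — along every asymptotically scaling regularisation with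
  `N_f ≤ 16` the inverse bare coupling diverges, `β_k → +∞` (two-loop profile `2b₀ℓ + 2(b₁/b₀) log ℓ`,
  `ℓ = log(1/(a_k²Λ²)) → +∞`, `b₀ > 0`; `b₁` of either sign is dominated since `log ℓ = o(ℓ)`);
* `tendsto_L_atTop` — the torus half-sides diverge, `L_k → ∞` (`a_k L_k → ∞`, `a_k → 0`);
* `transfer_zero_flavours` — the `N_f = 0` instance of `TransferStmt`: with no flavours the tilt is the
  empty product `1`, the phase-quenched ratio is `μ_W(flat set)/μ_W(univ) = μ_W(flat set)` (the Wilson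
  measure is a probability measure), and the gauge-sector flat-block law `e^{−8|A|}` for `β ≥ β₀`,
  `S ≥ S₀` gives the phase-quenched law `e^{−7|A|}` eventually in `k` on every torus `2S+1 ≥ 2L_k+1`,
  because `β_k ≥ β₀` and `L_k ≥ S₀` eventually.  The gauge-sector law (`GaugeFlatLD` of the skeleton,
  itself the conjunction of the open stubs S1 + S2) enters as an explicit hypothesis.
-/

noncomputable section

namespace Summit.QuantumFields.QCD.Cruxes.WindowExtinction.ChessboardColdCells

open scoped BigOperators
open MeasureTheory Filter Topology
open Literature.MathematicalPhysics.QuantumLattice Literature.MathematicalPhysics.QuantumFieldTheory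
  Literature.Probability.LatticeModels

/-- The two-loop profile diverges along every scaling sequence for `N_f ≤ 16` (`b₀ > 0`, `b₁` of either
sign): `afBeta N_f Λ a_k → +∞` as `a_k → 0⁺`, `Λ > 0`. -/
theorem tendsto_afBeta_atTop_of_le_sixteen {Nf : ℕ} (hNf : Nf ≤ 16) {a : ℕ → ℝ} (ha : ∀ k, 0 < a k)
    (ha₀ : Tendsto a atTop (𝓝 0)) {Λ : ℝ} (hΛ : 0 < Λ) :
    Tendsto (fun k => afBeta Nf Λ (a k)) atTop atTop := by
  have hb₀ : 0 < betaCoeff₀ Nf :=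
    Summit.QuantumFields.QCD.Theorems.betaCoeff₀_pos_of_le_sixteen hNf
  -- the large logarithm `ℓ_k = log(1/(a_k²Λ²)) → +∞`
  have hu : Tendsto (fun k => 1 / (a k ^ 2 * Λ ^ 2)) atTop atTop := by
    simp only [one_div]
    refine tendsto_inv_nhdsGT_zero.comp ?_
    refine tendsto_nhdsWithin_iff.2 ⟨?_, Eventually.of_forall fun k => ?_⟩
    · simpa using (ha₀.pow 2).mul_const (Λ ^ 2)
    · exact Set.mem_Ioi.2 (by have := ha k; positivity)
  have hℓ : Tendsto (fun k => Real.log (1 / (a k ^ 2 * Λ ^ 2))) atTop atTop :=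
    Real.tendsto_log_atTop.comp hu
  -- `log ℓ / ℓ → 0`, so the bracket `2b₀ + 2(b₁/b₀)(log ℓ/ℓ) → 2b₀ > 0`
  have h1 : Tendsto (fun k => Real.log (Real.log (1 / (a k ^ 2 * Λ ^ 2))) /
      Real.log (1 / (a k ^ 2 * Λ ^ 2))) atTop (𝓝 0) :=
    Real.isLittleO_log_id_atTop.tendsto_div_nhds_zero.comp hℓ
  have h2 : Tendsto (fun k => 2 * betaCoeff₀ Nf + 2 * (betaCoeff₁ Nf / betaCoeff₀ Nf) *
      (Real.log (Real.log (1 / (a k ^ 2 * Λ ^ 2))) / Real.log (1 / (a k ^ 2 * Λ ^ 2)))) atTop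
      (𝓝 (2 * betaCoeff₀ Nf + 2 * (betaCoeff₁ Nf / betaCoeff₀ Nf) * 0)) :=
    (h1.const_mul _).const_add _
  rw [mul_zero, add_zero] at h2
  have h3 := hℓ.atTop_mul_pos (by positivity) h2
  refine h3.congr' ?_
  filter_upwards [hℓ.eventually_gt_atTop 0] with k hk
  unfold afBeta
  field_simp

/-- **`β_k → +∞`** along every asymptotically scaling regularisation with `N_f ≤ 16`. -/
theorem tendsto_beta_atTop_of_hasAsymptoticScaling : ∀ {Nf : ℕ}, Nf ≤ 16 →
    ∀ (reg : QCDRegularisation Nf), (reg.scheme 0 0 0).HasAsymptoticScaling →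
      Filter.Tendsto reg.β Filter.atTop Filter.atTop := by
  intro Nf hNf reg hAS
  obtain ⟨Λ, hΛ, hΛt⟩ := hAS
  have haf := tendsto_afBeta_atTop_of_le_sixteen hNf reg.a_pos reg.tendsto_a hΛ
  have h : Tendsto (fun k => ((reg.scheme 0 0 0).β k - afBeta Nf Λ ((reg.scheme 0 0 0).a k)) +
      afBeta Nf Λ (reg.a k)) atTop atTop := hΛt.add_atTop haf
  exact h.congr fun k => by
    change reg.β k - afBeta Nf Λ (reg.a k) + afBeta Nf Λ (reg.a k) = reg.β k; ring

/-- **`L_k → ∞`** along every regularisation (`a_k L_k → ∞` with `a_k → 0⁺`). -/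
theorem tendsto_L_atTop :
    ∀ {Nf : ℕ} (reg : QCDRegularisation Nf), Filter.Tendsto reg.L Filter.atTop Filter.atTop := by
  intro Nf reg
  have hR : Tendsto (fun k => (reg.L k : ℝ)) atTop atTop := by
    refine tendsto_atTop_mono' atTop ?_ reg.tendsto_L
    filter_upwards [reg.tendsto_a.eventually (gt_mem_nhds one_pos)] with k hk
    have hL : (0 : ℝ) ≤ reg.L k := Nat.cast_nonneg _
    nlinarith [reg.a_pos k]
  exact tendsto_natCast_atTop_iff.1 hR

/-- **`stub_transfer` at `N_f = 0`** (the honest zero-flavour instance of `TransferStmt`): given the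
gauge-sector flat-block large deviation (`GaugeFlatLD`: `μ_W{all cubes of A flat at level flatLevel/β}
≤ e^{−8|A|}` for `β ≥ β₀` on every odd torus `2S+1`, `S ≥ S₀`), the phase-quenched flat-block law
`PQFlatLD 0 reg` holds along every asymptotically scaling pure-gauge regularisation — the tilt is the empty
product, the ratio is `μ_W(flat set)`, and `β_k ≥ β₀`, `L_k ≥ S₀` eventually. -/
theorem transfer_zero_flavours :
    (∃ β₀ : ℝ, ∃ S₀ : ℕ, ∀ β : ℝ, β₀ ≤ β → ∀ S : ℕ, S₀ ≤ S →
      ∀ A : Finset (TorusSite 4 (2 * S + 1)),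
        (wilsonMeasure (d := 4) (L := 2 * S + 1) (fundamentalRep (Fin 3)) β)
          {U | ∀ y ∈ A, CubeFlat U y (flatLevel / β)} ≤ ENNReal.ofReal (Real.exp (-8 * A.card))) →
    ∀ (reg : QCDRegularisation 0), (reg.scheme 0 0 0).HasAsymptoticScaling → PQFlatLD 0 reg := by
  intro hG reg hAS
  obtain ⟨β₀, S₀, h⟩ := hG
  intro m _hm
  filter_upwards [(tendsto_beta_atTop_of_hasAsymptoticScaling (by norm_num) reg hAS).eventually_ge_atTop β₀,
    (tendsto_L_atTop reg).eventually_ge_atTop S₀] with k hβ hL S hS A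
  have key := h (reg.β k) hβ S (hL.trans hS) A
  have hμ : ((wilsonMeasure (d := 4) (L := 2 * S + 1) (fundamentalRep (Fin 3)) (reg.β k))
      {U | ∀ y ∈ A, CubeFlat U y (flatLevel / reg.β k)}).toReal ≤ Real.exp (-8 * A.card) :=
    ENNReal.toReal_le_of_le_ofReal (Real.exp_pos _).le key
  simp only [Finset.univ_eq_empty, Finset.prod_empty, integral_const, smul_eq_mul, mul_one,
    measureReal_def, Measure.restrict_apply_univ, measure_univ, ENNReal.toReal_one, div_one]
  refine hμ.trans (Real.exp_le_exp.2 ?_)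
  have : (0 : ℝ) ≤ A.card := Nat.cast_nonneg _
  nlinarith

/-- **Reduction of `stub_transfer` to the conditional tilt bound** (all `N_f ≤ 16`; pure bookkeeping).  The
OPEN content of S3 is exactly the hypothesis `hT`: eventually in `k`, on every torus `2S+1 ≥ 2L_k+1` and for
every set `A` of spatial unit 3-cubes, restricting the phase-quenched weight `T_k = ∏_f |det D_W(m_f(k))|` to
the flat event `F_A` costs at most one nat per cube against the product `μ_W(F_A) · ∫ T_k dμ_W`, i.e.
`E_W[T_k ; F_A] ≤ e^{|A|} μ_W(F_A) E_W[T_k]` (conditional expectation of the tilt given flatness exceeds its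
mean by at most `e^{|A|}`).  With the gauge-sector law `μ_W(F_A) ≤ e^{−8|A|}` (`GaugeFlatLD`, hypothesis `hG`)
and `β_k ≥ β₀`, `L_k ≥ S₀` eventually, this is `PQFlatLD N_f reg`. -/
theorem pqFlatLD_of_tilt :
    (∃ β₀ : ℝ, ∃ S₀ : ℕ, ∀ β : ℝ, β₀ ≤ β → ∀ S : ℕ, S₀ ≤ S →
      ∀ A : Finset (TorusSite 4 (2 * S + 1)),
        (wilsonMeasure (d := 4) (L := 2 * S + 1) (fundamentalRep (Fin 3)) β)
          {U | ∀ y ∈ A, CubeFlat U y (flatLevel / β)} ≤ ENNReal.ofReal (Real.exp (-8 * A.card))) →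
    ∀ {Nf : ℕ}, Nf ≤ 16 → ∀ (reg : QCDRegularisation Nf), (reg.scheme 0 0 0).HasAsymptoticScaling →
    (∀ m : Fin Nf → ℝ, (∀ f, 0 < m f) → ∀ᶠ k : ℕ in Filter.atTop, ∀ S : ℕ, reg.L k ≤ S →
      ∀ A : Finset (TorusSite 4 (2 * S + 1)),
        ∫ U in {U | ∀ y ∈ A, CubeFlat U y (flatLevel / reg.β k)},
            ∏ f : Fin Nf, ‖fermionDet (wilsonDirac (fundamentalRep (Fin 3)) U
              (reg.mcrit k + reg.a k * m f / reg.Zm k) 1)‖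
            ∂(wilsonMeasure (d := 4) (L := 2 * S + 1) (fundamentalRep (Fin 3)) (reg.β k)) ≤
          Real.exp (A.card) *
            ((wilsonMeasure (d := 4) (L := 2 * S + 1) (fundamentalRep (Fin 3)) (reg.β k))
                {U | ∀ y ∈ A, CubeFlat U y (flatLevel / reg.β k)}).toReal *
            ∫ U, ∏ f : Fin Nf, ‖fermionDet (wilsonDirac (fundamentalRep (Fin 3)) U
              (reg.mcrit k + reg.a k * m f / reg.Zm k) 1)‖
              ∂(wilsonMeasure (d := 4) (L := 2 * S + 1) (fundamentalRep (Fin 3)) (reg.β k))) →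
    PQFlatLD Nf reg := by
  intro hG Nf hNf reg hAS hT
  obtain ⟨β₀, S₀, h⟩ := hG
  intro m hm
  filter_upwards [(tendsto_beta_atTop_of_hasAsymptoticScaling hNf reg hAS).eventually_ge_atTop β₀,
    (tendsto_L_atTop reg).eventually_ge_atTop S₀, hT m hm] with k hβ hL hTk S hS A
  have key := h (reg.β k) hβ S (hL.trans hS) A
  have hTk := hTk S hS A
  -- abbreviations: the flat event, the measure, the tilt
  set F : Set (GaugeConfig 4 (2 * S + 1) (Matrix.specialUnitaryGroup (Fin 3) ℂ)) :=
    {U | ∀ y ∈ A, CubeFlat U y (flatLevel / reg.β k)} with hF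
  set μ := wilsonMeasure (d := 4) (L := 2 * S + 1) (fundamentalRep (Fin 3)) (reg.β k) with hμdef
  set T : GaugeConfig 4 (2 * S + 1) (Matrix.specialUnitaryGroup (Fin 3) ℂ) → ℝ := fun U =>
    ∏ f : Fin Nf, ‖fermionDet (wilsonDirac (fundamentalRep (Fin 3)) U
      (reg.mcrit k + reg.a k * m f / reg.Zm k) 1)‖ with hT_def
  have hμF : (μ F).toReal ≤ Real.exp (-8 * A.card) :=
    ENNReal.toReal_le_of_le_ofReal (Real.exp_pos _).le key
  have hT0 : ∀ U, 0 ≤ T U := fun U => Finset.prod_nonneg fun f _ => norm_nonneg _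
  have hZ : 0 ≤ ∫ U, T U ∂μ := integral_nonneg hT0
  have hcard : (0 : ℝ) ≤ A.card := Nat.cast_nonneg _
  have hexp : Real.exp (A.card) * Real.exp (-8 * A.card) = Real.exp (-7 * A.card) := by
    rw [← Real.exp_add]; congr 1; ring
  change (∫ U in F, T U ∂μ) / (∫ U, T U ∂μ) ≤ Real.exp (-7 * A.card)
  change ∫ U in F, T U ∂μ ≤ Real.exp (A.card) * (μ F).toReal * ∫ U, T U ∂μ at hTk
  rcases hZ.eq_or_lt with hZ0 | hZpos
  · rw [← hZ0, div_zero]; exact (Real.exp_pos _).le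
  · rw [div_le_iff₀ hZpos, ← hexp]
    refine hTk.trans ?_
    have h1 : Real.exp (A.card) * (μ F).toReal ≤ Real.exp (A.card) * Real.exp (-8 * A.card) :=
      mul_le_mul_of_nonneg_left hμF (Real.exp_pos _).le
    exact mul_le_mul_of_nonneg_right h1 hZ

end Summit.QuantumFields.QCD.Cruxes.WindowExtinction.ChessboardColdCells

end
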